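import Mathlib.Topology.MetricSpace.Sequences
import Mathlib.Analysis.SpecificLimits.Basic
import Literature.MathematicalPhysics.StatisticalMechanics.BarlowStacking
import Literature.MathematicalPhysics.StatisticalMechanics.LennardJonesClusters

/-!
# Line `vanishing-excess-truss-rigidity` (crux `CoarseGrains`, stmt-AtomisticToContinuum-9331):
# exact ⇒ approximate local rules by compactness

Stub `stub_compactness` of the line skeleton: for `(a, h)` in the box, GIVEN the exact
local-to-global theorem for the HCP point set `P` (a set `X ∋ 0` all of whose points of norm
`≤ R + 6` satisfy the exact radius-`4` rule admits one global linear-isometric chart on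
`B̄(0, R + 1)`), for all `δ, R, ε > 0` there are `θ > 0` and `R' ≥ 0` such that in every
`δ`-separated finite configuration a particle all of whose fellows within `R'` are `Good(4, θ)` is
`Good(R, ε)` (`Good(ρ, η)` at particle `i` = an origin-based linear-isometric chart two-way
`η`-matching the particles within `ρ` of `x i` with `x i + A (P ∩ B̄ ρ)`).

Proof (compactness and contradiction, `R' := R + 7`, `θₙ := 1/(n+1)`; the helper lemmas and the
set-level core `compactness_core` are stated for a point set `P` of any finite-dimensional real
normed space `V` with `P ∩ B̄(0, 5)` finite — for `P = hcp(a, h)` this is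
`PeriodicConfiguration.finite_inter_points`).  If the claim fails for every `θₙ`, pick offending
configurations `xₙ` with bad particle `iₙ`.  The particles within `R + 12` of `xₙ iₙ` are at
most `M + 1`, `M := ⌈(2(R+12)/δ + 1)^{dim V}⌉` (`card_le_of_separated_of_dist_le`), so the
relative positions `xₙ j − xₙ iₙ` are the values of a map `eₙ : Fin (M+1) → B̄(0, R+12)` with
`eₙ 0 = 0` (`compactness_exists_enum`); together with the charts `Aₙ l` of the particles behind
`eₙ l` (linear isometries, norm `≤ 1` in the proper space `V →L[ℝ] V`) they form a bounded
sequence in a proper space, whence a convergent subsequence `e_{φ n} → e`, `A_{φ n} l → B l`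
pointwise, the `B l` again linear isometries (`compactness_exists_limit`).  The finite set
`F := range e ∋ 0` satisfies the EXACT radius-`4` rule at each `z = e l` with `‖z‖ ≤ R + 6`, with
chart `B l` (`compactness_limit_rule_one`, `compactness_limit_rule_two`: if a required point were
missing from the finite candidate set — the values `e l'`, resp. `z + B l p` for `p` in the
finite `P ∩ B̄ 5` — then for large `n` all candidates would be `> θₙ` away, contradicting
`Good(4, θₙ)` of the particle behind `e_{φ n} l`).
The hypothesis then gives a global chart `C` of `F` on `B̄(0, R + 1)`, and for `n` large
(`e_{φ n}` uniformly `min ε 1`-close to `e`) the bad particle `i_{φ n}` is `Good(R, ε)` with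
chart `C` (`compactness_readout`) — contradiction.  All `[folklore]`.
-/

noncomputable section

namespace Summit.AtomisticToContinuum.Crystallization.Theorems.ExcessDecayLiouvilleCoarseGrains

open Literature.MathematicalPhysics.StatisticalMechanics
open Filter Topology Metric

section Generic

variable {V : Type*} [NormedAddCommGroup V] [NormedSpace ℝ V]

/-- **Encoding.** The `ρ`-neighbourhood of particle `i` of a `δ`-separated configuration `x` is
enumerated (with repetitions) by a map `g : Fin (M + 1) → Fin N` with `g 0 = i`, as soon as
`(2ρ/δ + 1) ^ dim V ≤ M` (the volume bound `card_le_of_separated_of_dist_le`). [folklore] -/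
theorem compactness_exists_enum [FiniteDimensional ℝ V] {N M : ℕ} (x : Fin N → V) (i : Fin N)
    {δ ρ : ℝ} (hδ : 0 < δ) (hρ : 0 ≤ ρ) (hsep : ∀ i j : Fin N, i ≠ j → δ ≤ dist (x i) (x j))
    (hM : (2 * ρ / δ + 1) ^ Module.finrank ℝ V ≤ (M : ℝ)) :
    ∃ g : Fin (M + 1) → Fin N, g 0 = i ∧ (∀ l, dist (x (g l)) (x i) ≤ ρ) ∧
      ∀ j, dist (x j) (x i) ≤ ρ → ∃ l, g l = j := by
  classical
  set S : Finset (Fin N) := Finset.univ.filter fun j => dist (x j) (x i) ≤ ρ with hS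
  have hmem : ∀ j, j ∈ S ↔ dist (x j) (x i) ≤ ρ := fun j => by simp [hS]
  have hinj : Function.Injective x := fun j j' hjj' => by
    by_contra hne
    have h1 := hsep j j' hne
    rw [hjj', dist_self] at h1
    exact absurd h1 (not_le.2 hδ)
  have hcard : S.card ≤ M := by
    have h1 := card_le_of_separated_of_dist_le (S.image x) (x i) hδ hρ
      (fun c hc => by
        obtain ⟨j, hj, rfl⟩ := Finset.mem_image.1 hc
        exact (hmem j).1 hj)
      (fun c hc d hd hcd => by
        obtain ⟨j, -, rfl⟩ := Finset.mem_image.1 hc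
        obtain ⟨j', -, rfl⟩ := Finset.mem_image.1 hd
        exact hsep j j' fun hjj' => hcd (by rw [hjj']))
    rw [Finset.card_image_of_injective _ hinj] at h1
    exact_mod_cast h1.trans hM
  refine ⟨Fin.cons i fun l =>
      if hl : (l : ℕ) < S.card then (S.equivFin.symm ⟨l, hl⟩ : Fin N) else i,
    by simp, fun l => ?_, fun j hj => ?_⟩
  · refine Fin.cases ?_ (fun l => ?_) l
    · simpa using hρ
    · simp only [Fin.cons_succ]
      split_ifs with hl
      · exact (hmem _).1 (S.equivFin.symm ⟨l, hl⟩).2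
      · simpa using hρ
  · set m := S.equivFin ⟨j, (hmem j).2 hj⟩ with hm
    refine ⟨Fin.succ ⟨m, lt_of_lt_of_le m.2 hcard⟩, ?_⟩
    simp only [Fin.cons_succ, dif_pos m.2]
    rw [Fin.eta, hm, Equiv.symm_apply_apply]

/-- **Extraction.** Simultaneous Bolzano–Weierstrass extraction for finitely many bounded sequences
of vectors and finitely many sequences of linear isometries of a finite-dimensional real normed
space `V`: the isometries are viewed in the proper space `V →L[ℝ] V`, where they have norm `≤ 1`;
norm preservation passes to the limit, so the limits are again linear isometries. [folklore] -/
theorem compactness_exists_limit [FiniteDimensional ℝ V] {M : ℕ} {C : ℝ} (u : ℕ → Fin (M + 1) → V)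
    (A : ℕ → Fin (M + 1) → V →ₗᵢ[ℝ] V) (hu : ∀ n l, ‖u n l‖ ≤ C) :
    ∃ (φ : ℕ → ℕ) (e : Fin (M + 1) → V) (B : Fin (M + 1) → V →ₗᵢ[ℝ] V), StrictMono φ ∧
      (∀ l, Tendsto (fun n => u (φ n) l) atTop (𝓝 (e l))) ∧
      ∀ l v, Tendsto (fun n => A (φ n) l v) atTop (𝓝 (B l v)) := by
  set w : ℕ → Fin (M + 1) → V × (V →L[ℝ] V) := fun n l => (u n l, (A n l).toContinuousLinearMap)
    with hw
  have hbdd : Bornology.IsBounded (Set.range w) := by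
    refine isBounded_iff_forall_norm_le.2 ⟨max C 1, ?_⟩
    rintro _ ⟨n, rfl⟩
    refine (pi_norm_le_iff_of_nonneg (le_max_of_le_right zero_le_one)).2 fun l => ?_
    simp only [hw, Prod.norm_mk]
    exact max_le_max (hu n l) (A n l).norm_toContinuousLinearMap_le
  obtain ⟨z, -, φ, hφ, hlim⟩ := tendsto_subseq_of_bounded hbdd fun n => Set.mem_range_self n
  have hl : ∀ l, Tendsto (fun n => w (φ n) l) atTop (𝓝 (z l)) := fun l => tendsto_pi_nhds.1 hlim l
  have hev : ∀ l v, Tendsto (fun n => A (φ n) l v) atTop (𝓝 ((z l).2 v)) := fun l v =>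
    ((ContinuousLinearMap.apply ℝ V v).continuous.tendsto _).comp (hl l).snd_nhds
  have hnorm : ∀ l v, ‖(z l).2 v‖ = ‖v‖ := fun l v =>
    tendsto_nhds_unique (hev l v).norm (by simp)
  exact ⟨φ, fun l => (z l).1, fun l => ⟨((z l).2 : V →ₗ[ℝ] V), hnorm l⟩, hφ,
    fun l => (hl l).fst_nhds, hev⟩

/-- **First exact local rule in the limit.** Along a sequence of configurations whose relative
positions `x n (g n l) - x n (i n)` converge to `e l` and whose charts converge pointwise to `B l`,
with tolerances `θ n → 0`: if the particles within `R + 7` of `x n (i n)` satisfy the first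
`Good(4, θ n)` clause, then every `e l` with `‖e l‖ ≤ R + 6` satisfies the first EXACT rule
`e l + B l p ∈ range e` (`p ∈ P`, `‖p‖ ≤ 4`). [folklore] -/
theorem compactness_limit_rule_one {P : Set V} {R : ℝ} {ι : Type*} [Finite ι] {N : ℕ → ℕ}
    {x : ∀ n, Fin (N n) → V} {i : ∀ n, Fin (N n)} {θ : ℕ → ℝ} {g : ∀ n, ι → Fin (N n)}
    {A : ℕ → ι → V →ₗᵢ[ℝ] V} {e : ι → V} {B : ι → V →ₗᵢ[ℝ] V}
    (hθ : Tendsto θ atTop (𝓝 0))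
    (he : ∀ l, Tendsto (fun n => x n (g n l) - x n (i n)) atTop (𝓝 (e l)))
    (hB : ∀ l v, Tendsto (fun n => A n l v) atTop (𝓝 (B l v)))
    (hsurj : ∀ n j, dist (x n j) (x n (i n)) ≤ R + 12 → ∃ l, g n l = j)
    (hgood : ∀ n l, dist (x n (g n l)) (x n (i n)) ≤ R + 7 → ∀ p ∈ P, ‖p‖ ≤ 4 →
      ∃ j, dist (x n j) (x n (g n l) + A n l p) ≤ θ n) :
    ∀ l, ‖e l‖ ≤ R + 6 → ∀ p ∈ P, ‖p‖ ≤ 4 → ∃ l', e l' = e l + B l p := by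
  intro l hl p hp hp4
  by_contra hcon
  push Not at hcon
  have h1 : ∀ᶠ n in atTop, ∀ l',
      θ n < dist (x n (g n l') - x n (i n)) (x n (g n l) - x n (i n) + A n l p) := by
    refine eventually_all.2 fun l' => ?_
    have hpos : 0 < dist (e l') (e l + B l p) - 0 := by simpa using dist_pos.2 (hcon l')
    exact ((((he l').dist ((he l).add (hB l p))).sub hθ).eventually (lt_mem_nhds hpos)).mono
      fun n hn => by linarith
  have h2 : ∀ᶠ n in atTop, ‖x n (g n l) - x n (i n)‖ < R + 7 :=
    (he l).norm.eventually (gt_mem_nhds (by linarith))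
  have h3 : ∀ᶠ n in atTop, θ n < 1 := hθ.eventually (gt_mem_nhds one_pos)
  obtain ⟨n, hn1, hn2, hn3⟩ := (h1.and (h2.and h3)).exists
  obtain ⟨j, hj⟩ := hgood n l (by rw [dist_eq_norm]; exact hn2.le) p hp hp4
  obtain ⟨l', hl'⟩ := hsurj n j (by
    calc dist (x n j) (x n (i n))
        ≤ dist (x n j) (x n (g n l) + A n l p) + dist (x n (g n l) + A n l p) (x n (g n l)) +
          dist (x n (g n l)) (x n (i n)) := dist_triangle4 _ _ _ _
      _ ≤ θ n + 4 + (R + 7) :=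
          add_le_add_three hj (by rw [dist_self_add_left, LinearIsometry.norm_map]; exact hp4)
            (by rw [dist_eq_norm]; exact hn2.le)
      _ ≤ R + 12 := by linarith)
  have key := hn1 l'
  rw [hl', show dist (x n j - x n (i n)) (x n (g n l) - x n (i n) + A n l p) =
      dist (x n j) (x n (g n l) + A n l p) by rw [dist_eq_norm, dist_eq_norm]; congr 1; abel] at key
  linarith

/-- **Second exact local rule in the limit.** In the setting of `compactness_limit_rule_one`,
if the particles within `R + 7` of `x n (i n)` satisfy the second `Good(4, θ n)` clause, then
every `e l'` within (open) distance `4` of an `e l` with `‖e l‖ ≤ R + 6` is `e l + B l p` for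
some `p ∈ P` — the candidate sites `p` range over the finite set `P ∩ B̄(0, 5)`. [folklore] -/
theorem compactness_limit_rule_two {P : Set V} (hP5 : (closedBall (0 : V) 5 ∩ P).Finite) {R : ℝ}
    {ι : Type*} {N : ℕ → ℕ} {x : ∀ n, Fin (N n) → V} {i : ∀ n, Fin (N n)} {θ : ℕ → ℝ}
    {g : ∀ n, ι → Fin (N n)} {A : ℕ → ι → V →ₗᵢ[ℝ] V} {e : ι → V} {B : ι → V →ₗᵢ[ℝ] V}
    (hθ : Tendsto θ atTop (𝓝 0))
    (he : ∀ l, Tendsto (fun n => x n (g n l) - x n (i n)) atTop (𝓝 (e l)))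
    (hB : ∀ l v, Tendsto (fun n => A n l v) atTop (𝓝 (B l v)))
    (hgood : ∀ n l, dist (x n (g n l)) (x n (i n)) ≤ R + 7 → ∀ j, dist (x n j) (x n (g n l)) ≤ 4 →
      ∃ p ∈ P, dist (x n j) (x n (g n l) + A n l p) ≤ θ n) :
    ∀ l, ‖e l‖ ≤ R + 6 → ∀ l', dist (e l') (e l) < 4 → ∃ p ∈ P, e l' = e l + B l p := by
  intro l hl l' hl'
  by_contra hcon
  push Not at hcon
  have h1 : ∀ᶠ n in atTop, ∀ p ∈ closedBall (0 : V) 5 ∩ P,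
      θ n < dist (x n (g n l') - x n (i n)) (x n (g n l) - x n (i n) + A n l p) := by
    refine hP5.eventually_all.2 fun p hp => ?_
    have hpos : 0 < dist (e l') (e l + B l p) - 0 := by simpa using dist_pos.2 (hcon p hp.2)
    exact ((((he l').dist ((he l).add (hB l p))).sub hθ).eventually (lt_mem_nhds hpos)).mono
      fun n hn => by linarith
  have h2 : ∀ᶠ n in atTop, ‖x n (g n l) - x n (i n)‖ < R + 7 :=
    (he l).norm.eventually (gt_mem_nhds (by linarith))
  have h3 : ∀ᶠ n in atTop, θ n < 1 := hθ.eventually (gt_mem_nhds one_pos)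
  have h4 : ∀ᶠ n in atTop, dist (x n (g n l') - x n (i n)) (x n (g n l) - x n (i n)) < 4 :=
    ((he l').dist (he l)).eventually (gt_mem_nhds hl')
  obtain ⟨n, hn1, hn2, hn3, hn4⟩ := (h1.and (h2.and (h3.and h4))).exists
  rw [dist_sub_right] at hn4
  obtain ⟨p, hp, hpθ⟩ := hgood n l (by rw [dist_eq_norm]; exact hn2.le) (g n l') hn4.le
  have hp5 : p ∈ closedBall (0 : V) 5 ∩ P := by
    refine ⟨mem_closedBall_zero_iff.2 ?_, hp⟩
    calc ‖p‖ = dist (x n (g n l) + A n l p) (x n (g n l)) := by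
          rw [dist_self_add_left, LinearIsometry.norm_map]
      _ ≤ dist (x n (g n l) + A n l p) (x n (g n l')) + dist (x n (g n l')) (x n (g n l)) :=
          dist_triangle _ _ _
      _ ≤ θ n + 4 := add_le_add (by rw [dist_comm]; exact hpθ) hn4.le
      _ ≤ 5 := by linarith
  have key := hn1 p hp5
  rw [show dist (x n (g n l') - x n (i n)) (x n (g n l) - x n (i n) + A n l p) =
      dist (x n (g n l')) (x n (g n l) + A n l p) by
        rw [dist_eq_norm, dist_eq_norm]; congr 1; abel] at key
  linarith

/-- **Read-out.** In the setting of `compactness_limit_rule_one`, a global chart `C` of `range e` on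
`B̄(0, R + 1)` (exact two-way matching with `C (P ∩ B̄(0, R + 1))`) makes, for `n` large, the
particle `i n` `Good(R, ε)` with chart `C`. [folklore] -/
theorem compactness_readout {P : Set V} {R ε : ℝ} (hε : 0 < ε) {ι : Type*} [Finite ι] {N : ℕ → ℕ}
    {x : ∀ n, Fin (N n) → V} {i : ∀ n, Fin (N n)} {g : ∀ n, ι → Fin (N n)} {e : ι → V}
    (he : ∀ l, Tendsto (fun n => x n (g n l) - x n (i n)) atTop (𝓝 (e l)))
    (hsurj : ∀ n j, dist (x n j) (x n (i n)) ≤ R + 12 → ∃ l, g n l = j)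
    {C : V →ₗᵢ[ℝ] V} (hC1 : ∀ p ∈ P, ‖p‖ ≤ R + 1 → ∃ l, e l = C p)
    (hC2 : ∀ l, ‖e l‖ ≤ R + 1 → ∃ p ∈ P, e l = C p) :
    ∃ n, (∀ p ∈ P, ‖p‖ ≤ R → ∃ j, dist (x n j) (x n (i n) + C p) ≤ ε) ∧
      (∀ j, dist (x n j) (x n (i n)) ≤ R → ∃ p ∈ P, dist (x n j) (x n (i n) + C p) ≤ ε) := by
  have h1 : ∀ᶠ n in atTop, ∀ l, dist (x n (g n l) - x n (i n)) (e l) < min ε 1 :=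
    eventually_all.2 fun l => Metric.tendsto_nhds.1 (he l) _ (by positivity)
  obtain ⟨n, hn⟩ := h1.exists
  have hdist : ∀ l q, e l = C q → dist (x n (g n l)) (x n (i n) + C q) < min ε 1 := by
    intro l q hq
    rw [← hq, show dist (x n (g n l)) (x n (i n) + e l) = dist (x n (g n l) - x n (i n)) (e l) by
      rw [dist_eq_norm, dist_eq_norm]; congr 1; abel]
    exact hn l
  refine ⟨n, fun p hp hpR => ?_, fun j hj => ?_⟩
  · obtain ⟨l, hl⟩ := hC1 p hp (by linarith)
    exact ⟨g n l, ((hdist l p hl).trans_le (min_le_left _ _)).le⟩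
  · obtain ⟨l, rfl⟩ := hsurj n j (by linarith)
    have hnorm : ‖e l‖ ≤ R + 1 :=
      calc ‖e l‖ ≤ ‖x n (g n l) - x n (i n)‖ + ‖x n (g n l) - x n (i n) - e l‖ :=
            norm_le_norm_add_norm_sub _ _
        _ ≤ R + 1 := by
            rw [← dist_eq_norm, ← dist_eq_norm]
            linarith [(hn l).le.trans (min_le_right ε 1)]
    obtain ⟨p, hp, hpe⟩ := hC2 l hnorm
    exact ⟨p, hp, ((hdist l p hpe).trans_le (min_le_left _ _)).le⟩

/-- **Core (set-level form).** For a point set `P` of a finite-dimensional real normed space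
with `P ∩ B̄(0,5)` finite, the exact
local-to-global theorem implies the approximate propagation statement with `R' = R + 7`:
contradiction + `compactness_exists_enum` + `compactness_exists_limit` +
`compactness_limit_rule_one/two` + `compactness_readout`. [folklore] -/
theorem compactness_core [FiniteDimensional ℝ V] {P : Set V}
    (hP5 : (closedBall (0 : V) 5 ∩ P).Finite)
    (HEX : ∀ R : ℝ, 0 < R → ∀ X : Set V, (0 : V) ∈ X →
      (∀ x ∈ X, ‖x‖ ≤ R + 6 → ∃ A : V →ₗᵢ[ℝ] V,
        (∀ p ∈ P, ‖p‖ ≤ 4 → x + A p ∈ X) ∧ (∀ y ∈ X, dist y x < 4 → ∃ p ∈ P, y = x + A p)) →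
      ∃ A : V →ₗᵢ[ℝ] V, (∀ p ∈ P, ‖p‖ ≤ R + 1 → A p ∈ X) ∧
        (∀ y ∈ X, ‖y‖ ≤ R + 1 → ∃ p ∈ P, y = A p))
    {δ R ε : ℝ} (hδ : 0 < δ) (hR : 0 < R) (hε : 0 < ε) :
    ∃ θ : ℝ, 0 < θ ∧ ∀ (N : ℕ) (x : Fin N → V), (∀ i j : Fin N, i ≠ j → δ ≤ dist (x i) (x j)) →
      ∀ i : Fin N, (∀ j : Fin N, dist (x j) (x i) ≤ R + 7 → ∃ A : V →ₗᵢ[ℝ] V,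
        (∀ p ∈ P, ‖p‖ ≤ 4 → ∃ j', dist (x j') (x j + A p) ≤ θ) ∧
        (∀ j', dist (x j') (x j) ≤ 4 → ∃ p ∈ P, dist (x j') (x j + A p) ≤ θ)) →
      ∃ A : V →ₗᵢ[ℝ] V, (∀ p ∈ P, ‖p‖ ≤ R → ∃ j, dist (x j) (x i + A p) ≤ ε) ∧
        (∀ j, dist (x j) (x i) ≤ R → ∃ p ∈ P, dist (x j) (x i + A p) ≤ ε) := by
  by_contra H
  have key : ∀ n : ℕ, ∃ (N : ℕ) (x : Fin N → V) (i : Fin N),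
      (∀ i j : Fin N, i ≠ j → δ ≤ dist (x i) (x j)) ∧
      (∀ j : Fin N, dist (x j) (x i) ≤ R + 7 → ∃ A : V →ₗᵢ[ℝ] V,
        (∀ p ∈ P, ‖p‖ ≤ 4 → ∃ j', dist (x j') (x j + A p) ≤ 1 / ((n : ℝ) + 1)) ∧
        (∀ j', dist (x j') (x j) ≤ 4 → ∃ p ∈ P, dist (x j') (x j + A p) ≤ 1 / ((n : ℝ) + 1))) ∧
      ¬ ∃ A : V →ₗᵢ[ℝ] V, (∀ p ∈ P, ‖p‖ ≤ R → ∃ j, dist (x j) (x i + A p) ≤ ε) ∧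
        (∀ j, dist (x j) (x i) ≤ R → ∃ p ∈ P, dist (x j) (x i + A p) ≤ ε) := by
    intro n
    by_contra hn
    refine H ⟨1 / ((n : ℝ) + 1), by positivity, fun N x hsep i hi => ?_⟩
    by_contra hbad
    exact hn ⟨N, x, i, hsep, hi, hbad⟩
  choose N x i hsep hloc hbad using key
  obtain ⟨M, hM⟩ : ∃ M : ℕ, (2 * (R + 12) / δ + 1) ^ Module.finrank ℝ V ≤ (M : ℝ) :=
    ⟨_, Nat.le_ceil _⟩
  choose g hg0 hgS hgsurj using fun n =>
    compactness_exists_enum (x n) (i n) hδ (by positivity : (0 : ℝ) ≤ R + 12) (hsep n) hM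
  have hchart : ∀ n (l : Fin (M + 1)), ∃ A : V →ₗᵢ[ℝ] V,
      dist (x n (g n l)) (x n (i n)) ≤ R + 7 →
      (∀ p ∈ P, ‖p‖ ≤ 4 → ∃ j', dist (x n j') (x n (g n l) + A p) ≤ 1 / ((n : ℝ) + 1)) ∧
      (∀ j', dist (x n j') (x n (g n l)) ≤ 4 →
        ∃ p ∈ P, dist (x n j') (x n (g n l) + A p) ≤ 1 / ((n : ℝ) + 1)) := fun n l => by
    by_cases hd : dist (x n (g n l)) (x n (i n)) ≤ R + 7
    · obtain ⟨A, hA⟩ := hloc n (g n l) hd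
      exact ⟨A, fun _ => hA⟩
    · exact ⟨LinearIsometry.id, fun h => absurd h hd⟩
  choose A hA using hchart
  obtain ⟨φ, e, B, hφ, he, hB⟩ := compactness_exists_limit (fun n l => x n (g n l) - x n (i n)) A
    (C := R + 12) fun n l => by rw [← dist_eq_norm]; exact hgS n l
  have hθ : Tendsto (fun n => 1 / ((φ n : ℝ) + 1)) atTop (𝓝 0) :=
    tendsto_one_div_add_atTop_nhds_zero_nat.comp hφ.tendsto_atTop
  have hsurj' : ∀ n j, dist (x (φ n) j) (x (φ n) (i (φ n))) ≤ R + 12 → ∃ l, g (φ n) l = j :=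
    fun n => hgsurj (φ n)
  have rule1 := compactness_limit_rule_one (P := P) (R := R) (N := fun n => N (φ n))
    (x := fun n => x (φ n)) (i := fun n => i (φ n)) (θ := fun n => 1 / ((φ n : ℝ) + 1))
    (g := fun n => g (φ n)) (A := fun n => A (φ n)) (e := e) (B := B) hθ he hB hsurj'
    fun n l hd => (hA (φ n) l hd).1
  have rule2 := compactness_limit_rule_two hP5 (R := R) (N := fun n => N (φ n))
    (x := fun n => x (φ n)) (i := fun n => i (φ n)) (θ := fun n => 1 / ((φ n : ℝ) + 1))
    (g := fun n => g (φ n)) (A := fun n => A (φ n)) (e := e) (B := B) hθ he hB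
    fun n l hd => (hA (φ n) l hd).2
  have h0 : e 0 = 0 :=
    tendsto_nhds_unique (he 0) (tendsto_const_nhds.congr fun n => by simp [hg0])
  obtain ⟨C, hC1, hC2⟩ := HEX R hR (Set.range e) ⟨0, h0⟩ (by
    rintro _ ⟨l, rfl⟩ hl
    refine ⟨B l, fun p hp hp4 => ?_, ?_⟩
    · obtain ⟨l', hl'⟩ := rule1 l hl p hp hp4
      exact ⟨l', hl'⟩
    · rintro _ ⟨l', rfl⟩ hd
      exact rule2 l hl l' hd)
  obtain ⟨n, hn⟩ := compactness_readout (P := P) (R := R) hε (N := fun n => N (φ n))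
    (x := fun n => x (φ n)) (i := fun n => i (φ n)) (g := fun n => g (φ n)) (e := e) he hsurj'
    (C := C) (fun p hp hpR => hC1 p hp hpR) (fun l hl => hC2 (e l) ⟨l, rfl⟩ hl)
  exact hbad (φ n) ⟨C, hn⟩

end Generic

/-- **Stub F — exact to approximate by compactness** (stub `stub_compactness` of line
`vanishing-excess-truss-rigidity`, crux `CoarseGrains`). For `(a,h)` in the box, given the exact
local-to-global theorem for `hcp(a,h)` (as a hypothesis): for all `δ, R, ε > 0` there are `θ > 0`,
`R' ≥ 0` (`R' = R + 7`) such that in a `δ`-separated finite configuration a particle all of whose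
fellows within `R'` are `Good(4,θ)` is `Good(R,ε)`: `compactness_core` for the locally finite
point set `P = hcp(a,h)` (`PeriodicConfiguration.finite_inter_points`). [folklore] -/
theorem stub_compactness :
    ∀ (a h : ℝ) (ha : a ≠ 0) (hh : h ≠ 0), 47 / 50 ≤ a → a ≤ 1 → 39 / 50 * a ≤ h → h ≤ 17 / 20 * a →
    (∀ R : ℝ, 0 < R → ∀ X : Set (EuclideanSpace ℝ (Fin 3)), (0 : EuclideanSpace ℝ (Fin 3)) ∈ X →
      (∀ x ∈ X, ‖x‖ ≤ R + 6 → ∃ A : EuclideanSpace ℝ (Fin 3) →ₗᵢ[ℝ] EuclideanSpace ℝ (Fin 3),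
        (∀ p ∈ (hcpPeriodicConfiguration ha hh).points, ‖p‖ ≤ 4 → x + A p ∈ X) ∧
        (∀ y ∈ X, dist y x < 4 → ∃ p ∈ (hcpPeriodicConfiguration ha hh).points, y = x + A p)) →
      ∃ A : EuclideanSpace ℝ (Fin 3) →ₗᵢ[ℝ] EuclideanSpace ℝ (Fin 3),
        (∀ p ∈ (hcpPeriodicConfiguration ha hh).points, ‖p‖ ≤ R + 1 → A p ∈ X) ∧
        (∀ y ∈ X, ‖y‖ ≤ R + 1 → ∃ p ∈ (hcpPeriodicConfiguration ha hh).points, y = A p)) →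
    ∀ δ R ε : ℝ, 0 < δ → 0 < R → 0 < ε → ∃ θ : ℝ, 0 < θ ∧ ∃ R' : ℝ, 0 ≤ R' ∧
    ∀ (N : ℕ) (x : Fin N → EuclideanSpace ℝ (Fin 3)),
      (∀ i j : Fin N, i ≠ j → δ ≤ dist (x i) (x j)) →
    let Good : ℝ → ℝ → Fin N → Prop := fun ρ η i =>
      ∃ A : EuclideanSpace ℝ (Fin 3) →ₗᵢ[ℝ] EuclideanSpace ℝ (Fin 3),
        (∀ p ∈ (hcpPeriodicConfiguration ha hh).points, ‖p‖ ≤ ρ →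
          ∃ j : Fin N, dist (x j) (x i + A p) ≤ η) ∧
        (∀ j : Fin N, dist (x j) (x i) ≤ ρ →
          ∃ p ∈ (hcpPeriodicConfiguration ha hh).points, dist (x j) (x i + A p) ≤ η);
    ∀ i : Fin N, (∀ j : Fin N, dist (x j) (x i) ≤ R' → Good 4 θ j) → Good R ε i := by
  intro a h ha hh _ _ _ _ HEX δ R ε hδ hR hε
  obtain ⟨θ, hθ, H⟩ := compactness_core
    ((hcpPeriodicConfiguration ha hh).finite_inter_points isBounded_closedBall) HEX hδ hR hε
  refine ⟨θ, hθ, R + 7, by positivity, fun N x hsep => ?_⟩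
  intro Good i hi
  exact H N x hsep i hi

end Summit.AtomisticToContinuum.Crystallization.Theorems.ExcessDecayLiouvilleCoarseGrains

end
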